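import Literature.AnabelianGeometry.AbsoluteAnabelian.AbsTopIII.Thm19DictionaryBridgeOrders
import Literature.AnabelianGeometry.AbsoluteAnabelian.AbsTopIII.CyclotomeH1Restriction
import Literature.AnabelianGeometry.AbsoluteAnabelian.AbsTopIII.LinearSystemsValuesProofs
import Literature.AnabelianGeometry.AbsoluteAnabelian.AbsTopIII.KummerFaithfulBaseChangeProofs
import Literature.AnabelianGeometry.AbsoluteAnabelian.AbsTopIII.KummerPUKerProofs
import HarnessLib

/-!
# [AbsTopIII] Thm. 1.9 (e): the VALUE dictionary of a saturated tagged system, derived from the per-curve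
# laws (proof-only; part 3 of the (e)-bridge: `HasValueOneAt` versus "`f(x) = 1`")

Mochizuki, *Topics in Absolute Anabelian Geometry III*, §1, Theorem 1.9 (e), manuscript p. 38, with
Prop. 1.3 (c) p. 30 ("the subgroup `U_v ⊆ K_X^×` given by the `f ∈ K_X^×` such that `f(x) = 1`") and Prop.
1.8 (ii) p. 36 ("`κ_U(f)|_x = η|_{G_{k_x}}`") (lit key `paper:url-5493eb38cbb7`).

Cell abc-iut, sub-DAG `plan/L4/SUBDAG-AbsTopIII-Thm19.md`, row Thm19.e.r11; the (e)-BRIDGE of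
abc-iut-L4-lead RULING #5j (3), part (e3) VALUES, over the six-layer law tower `PlacedKummerModelV2`.  For a
regular unit `g₀` of a level descending to `u ∈ K_{Z_NF}^×`, the container-level predicate
`HasValueOneAt (κ(g₀)) x` of abc-iut-w5-d213's extracted triple (∃ a level, a decomposition group of a
point or cusp lying over `x`, a representing class VANISHING on it) holds IFF `u ∈ U_v` ("`u(v) = 1`") at
the place `v` named by `x`.  Readings: at a POINT decomposition group by law (E) (`κ(g)|_{D_w} =
κ(g(w))|_{D_w}`, Kummer-faithfulness) and layer III's (e3) `mem_unitsWithValueOne_nfPlace_iff`; at a CUSP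
`c` filling `y` by extending `g` across `c` when `ord_y g = 0` (`exists_open_between`), the naturality
(N) of the Kummer map, `D_c ↠ D_y` up to conjugacy (`decomp_cuspPt`) and the restriction calculus of
`CyclotomeH1Restriction.lean` — the case `ord_y g ≠ 0` being excluded by the degree of a Kummer class
(law (D)) and the uniqueness of integral degrees (abc-iut-L4-t4).  All theorems; no definition, no new
named fact; nothing here bears on [IUTchIII] Cor. 3.12.
-/

noncomputable section

open CategoryTheory
open scoped Pointwise

namespace Literature.AnabelianGeometry.AbsoluteAnabelian.AbsTopIII

open Literature.NumberTheory.DiophantineGeometry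
open Literature.NumberTheory.DiophantineGeometry.AlgFunctionField

universe u

namespace PlacedKummerModelV2

variable (N : PlacedKummerModelV2.{u}) {Z : N.Curve}

/-! ### Reading "value one" at a point decomposition group -/

/-- **At a rational point `w` of a cofinite open `U` of a level `Z′ = Z ×_k k′`: `κ_U(g)|_{D_w} = 0` iff
`u(v) = 1`**, `u ∈ K_{Z_NF}^×` the element `g` descends to and `v` the place named by `w` (law (E):
`κ(g)|_{D_w} = κ(g(w))|_{D_w}` and Kummer-faithfulness; layer III (e3)).
[cite: MochizukiAbsTopIII2015, Prop 1.8 (ii) p.36] -/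
theorem classRes_decomp_kummer_eq_zero_iff {U Z' : N.Curve} (hU : N.IsCofiniteOpen U Z')
    (hZ' : N.IsBaseChangeOf Z' Z) (hp : N.IsProper Z') (w : N.Point U)
    (hwNF : N.IsNFPoint Z' (N.ptRes hU w)) (hwr : N.IsRationalPt U w)
    (hkf : IsKummerFaithful (N.base U)) (g : N.regularUnits U) (u : (N.NFFunctionField Z)ˣ)
    (hrep : letI := N.instGeomField Z;
      N.toGeom hZ' ((N.fieldRes hU).symm ((g : (N.FunctionField U)ˣ) : _)) =
        N.nfToGeom Z (u : N.NFFunctionField Z)) :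
    N.classRes hU (N.decomp U w) (N.kummerAddHom hU hp (Additive.ofMul g)) = 0 ↔
      u ∈ @unitsWithValueOne _ (N.NFFunctionField Z) _ _ (N.nfAlgebra Z)
        (N.nfPlace hZ' (N.ptRes hU w) hwNF ((N.isRationalPt_ptRes hU w).2 hwr)) := by
  letI := N.instGeomField Z
  have hc := (N.constUnit (N.evalAt w hwr g)).2
  rw [N.kummerAddHom_apply, N.classRes_kummer, N.kummerRes_decomp_evalAt hU hp w hwr g hc,
    N.kummerRes_decomp_const_eq_zero_iff hU hp w hwr hkf _ hc]
  exact (N.mem_unitsWithValueOne_nfPlace_iff hZ' hU w hwNF ((N.isRationalPt_ptRes hU w).2 hwr) hwr g u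
    hrep).symm

/-! ### Extending a regular unit across a cusp where it has order `0` -/

/-- **A regular unit of `U` of order `0` at the point `y` filled by the cusp `c` extends across `c`**:
there is a cofinite open `U ⊆ U′ ⊆ X` in which `c` fills a point `y′ ↦ y` and a regular unit `g′` of
`U′` restricting to `g` (`exists_open_between`; regularity at `y′` is `ord_y g = 0`, `ord_ptRes`;
elsewhere the points of `U′` are points of `U`). [cite: MochizukiAbsTopIII2015, Prop 1.6 (iii) p.35] -/
theorem exists_extension_across_cusp {U X : N.Curve} (h : N.IsCofiniteOpen U X)
    (c : (N.cusps U).Cusp) (y : N.Point X) (hc : N.cuspPt h c = some y) (g : N.regularUnits U)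
    (hord : N.ord y (Units.map (N.fieldRes h).symm.toRingHom.toMonoidHom
      (g : (N.FunctionField U)ˣ)) = 1) :
    ∃ (U' : N.Curve) (h₁ : N.IsCofiniteOpen U U') (h₂ : N.IsCofiniteOpen U' X) (y' : N.Point U')
      (g' : N.regularUnits U'),
      N.cuspPt h₁ c = some y' ∧ N.ptRes h₂ y' = y ∧
        N.unitRes h₁ (Additive.ofMul g') = Additive.ofMul g ∧
        (N.fieldRes h₂).symm ((g' : (N.FunctionField U')ˣ) : N.FunctionField U') =
          (N.fieldRes h).symm ((g : (N.FunctionField U)ˣ) : N.FunctionField U) := by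
  obtain ⟨U', h₁, h₂, hiff⟩ := N.exists_open_between h {c} (by
    intro c' hc'
    rw [Set.mem_singleton_iff] at hc'
    subst hc'
    rw [hc]
    rfl)
  have hcU : N.cuspPt h₁ c ≠ none := fun h0 => (hiff c).1 h0 (Set.mem_singleton c)
  obtain ⟨y', hy'⟩ := Option.ne_none_iff_exists'.mp hcU
  have hyy' : N.ptRes h₂ y' = y := by
    have h1 := N.cuspPt_comp_some h₁ h₂ h c y' hy'
    rw [hc] at h1
    exact (Option.some_injective _ h1).symm
  -- the extension of `g` to `U'`
  set ĝ : (N.FunctionField X)ˣ :=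
    Units.map (N.fieldRes h).symm.toRingHom.toMonoidHom (g : (N.FunctionField U)ˣ) with hĝ
  set gu : (N.FunctionField U')ˣ := Units.map (N.fieldRes h₂).toRingHom.toMonoidHom ĝ with hgu
  have hres : Units.map (N.fieldRes h₁).toRingHom.toMonoidHom gu = (g : (N.FunctionField U)ˣ) := by
    apply Units.ext
    simp only [hgu, hĝ, Units.coe_map, RingHom.toMonoidHom_eq_coe, MonoidHom.coe_coe,
      RingEquiv.toRingHom_eq_coe, RingEquiv.coe_toRingHom]
    rw [← N.fieldRes_comp h₁ h₂ h, RingEquiv.apply_symm_apply]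
  have hreg : gu ∈ N.regularUnits U' := by
    rw [N.mem_regularUnits]
    intro x
    rcases N.exists_ptRes_or_cuspPt h₁ x with ⟨x₀, rfl⟩ | ⟨c', hc'⟩
    · rw [N.ord_ptRes h₁ x₀, hres]
      exact g.2 x₀
    · have hc'c : c' = c := by
        by_contra hne
        exact absurd hc' (by rw [(hiff c').2 (by simpa using hne)]; simp)
      subst hc'c
      rw [hy'] at hc'
      cases hc'
      have h1 := N.ord_ptRes h₂ y' ĝ
      rw [hyy'] at h1
      rw [← h1]
      exact hord
  refine ⟨U', h₁, h₂, y', ⟨gu, hreg⟩, hy', hyy', ?_, ?_⟩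
  · apply Additive.toMul.injective
    apply Subtype.ext
    rw [N.coe_unitRes]
    exact hres
  · change (N.fieldRes h₂).symm (N.fieldRes h₂ ((N.fieldRes h).symm _)) = _
    rw [RingEquiv.symm_apply_apply]

/-! ### Reading "value one" at a cusp decomposition group -/

section Cusp

variable {U Z' : N.Curve} (hU : N.IsCofiniteOpen U Z') (hZ' : N.IsBaseChangeOf Z' Z)
  (hp : N.IsProper Z') (P : N.toCurveModel.CuspSyncPresentation hU) (c : (N.cusps U).Cusp)
  (y : N.Point Z') (hc : N.cuspPt hU c = some y) (hyNF : N.IsNFPoint Z' y) (hyr : N.IsRationalPt Z' y)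
  (hkf : IsKummerFaithful (N.base U)) (g : N.regularUnits U) (u : (N.NFFunctionField Z)ˣ)
  (hrep : letI := N.instGeomField Z;
    N.toGeom hZ' ((N.fieldRes hU).symm ((g : (N.FunctionField U)ˣ) : _)) =
      N.nfToGeom Z (u : N.NFFunctionField Z))

include hc hrep hkf

/-- **At a cusp `c` of `U` filling the rational NF-point `y` of `Z′`: if `ord_y g = 0` then
`κ_U(g)|_{D_c} = 0` iff `u(v) = 1`**, `v` the place named by `y` — extend `g` across `c`
(`exists_extension_across_cusp`), use the naturality (N) of the Kummer map, `D_c ↠ D_{y′}` up to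
conjugacy (`decomp_cuspPt`), the restriction calculus, and the point reading at `y′`.
[cite: MochizukiAbsTopIII2015, Thm 1.9 (e) p.38] -/
theorem classRes_dcusp_kummer_eq_zero_iff_of_ord
    (hord : N.ord y (Units.map (N.fieldRes hU).symm.toRingHom.toMonoidHom
      (g : (N.FunctionField U)ˣ)) = 1) :
    N.classRes hU ((N.cusps U).Dcusp c) (N.kummerAddHom hU hp (Additive.ofMul g)) = 0 ↔
      u ∈ @unitsWithValueOne _ (N.NFFunctionField Z) _ _ (N.nfAlgebra Z) (N.nfPlace hZ' y hyNF hyr) := by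
  letI := N.instGeomField Z
  obtain ⟨U', h₁, h₂, y', g', hy', hyy', hres, hval⟩ := N.exists_extension_across_cusp hU c y hc g hord
  -- naturality: `κ_U(g) = res^* κ_{U'}(g')`
  have hnat : N.kummerAddHom hU hp (Additive.ofMul g) =
      (cyclotomeModH1Pull ZHatCoeff.{u} (N.res h₁) (N.res h₂) (N.res hU) (N.res_comp h₁ h₂ hU)).hom
        (N.kummerAddHom h₂ hp (Additive.ofMul g')) := by
    rw [← hres]
    exact N.kummerAddHom_unitRes h₁ h₂ hU hp g'
  -- `D_c` maps onto a conjugate of `D_{y'}`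
  obtain ⟨γ, hγ⟩ := N.decomp_cuspPt h₁ c y' hy'
  -- the point reading at `y'`
  have hy'NF : N.IsNFPoint Z' (N.ptRes h₂ y') := by rw [hyy']; exact hyNF
  have hy'r : N.IsRationalPt U' y' := by
    rw [← N.isRationalPt_ptRes h₂ y', hyy']; exact hyr
  have hkf' : IsKummerFaithful (N.base U') := by
    -- `k_{U'} = k_U` (`baseRes`): transport Kummer-faithfulness along the isomorphism of base fields
    exact hkf.of_ringHom (N.baseRes h₁).toRingHom
  have hpt := N.classRes_decomp_kummer_eq_zero_iff h₂ hZ' hp y' hy'NF hy'r hkf' g' u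
    (by rw [hval]; exact hrep)
  have hplace : N.nfPlace hZ' (N.ptRes h₂ y') hy'NF ((N.isRationalPt_ptRes h₂ y').2 hy'r) =
      N.nfPlace hZ' y hyNF hyr := N.nfPlace_congr hZ' hyy' _ _ _ _
  rw [← hplace, ← hpt, hnat]
  change (cyclotomeModH1Res (N.res hU) ZHatCoeff.{u} ((N.cusps U).Dcusp c)).hom
      ((cyclotomeModH1Pull ZHatCoeff.{u} (N.res h₁) (N.res h₂) (N.res hU) (N.res_comp h₁ h₂ hU)).hom _) =
        0 ↔ (cyclotomeModH1Res (N.res h₂) ZHatCoeff.{u} (N.decomp U' y')).hom _ = 0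
  rw [res_pull_eq_zero_iff, hγ, res_conj_eq_zero_iff]

end Cusp

variable {ι : Type u} [Preorder ι]
  (S : CurveModel.NFComplementSystem N.toCurveModel Z ι)
  (T : CurveModel.NFComplementSystem.GeomTags N.toDescentKummerModel S)

/-- **At a cusp `c` of a level filling the rational NF-point `y`: `κ(g)|_{D_c} = 0` iff `u(v) = 1`**, `v`
the place named by `y` — unconditionally in `ord_y g`: if the restriction vanishes, it vanishes on `I_c`,
so the Kummer class has degree `0` at `c`, whence `ord_y g = 0` (law (D) + uniqueness of degrees); if
`u(v) = 1` then `ord_v u = 0 = ord_y g` (layer III `ord_nfPlace`); either way the previous reading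
applies. [cite: MochizukiAbsTopIII2015, Thm 1.9 (e) p.38] -/
theorem classRes_dcusp_kummer_eq_zero_iff (i : ι) (P : N.toCurveModel.CuspSyncPresentation (S.isOpen i))
    (c : (N.cusps (S.V i)).Cusp) (y : N.Point (S.Zb i)) (hc : N.cuspPt (S.isOpen i) c = some y)
    (hyNF : N.IsNFPoint (S.Zb i) y) (hyr : N.IsRationalPt (S.Zb i) y)
    (hkf : IsKummerFaithful (N.base (S.V i))) (g : N.regularUnits (S.V i)) (u : (N.NFFunctionField Z)ˣ)
    (hrep : letI := N.instGeomField Z;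
      N.toGeom (T.hZb i) ((N.fieldRes (S.isOpen i)).symm ((g : (N.FunctionField (S.V i))ˣ) : _)) =
        N.nfToGeom Z (u : N.NFFunctionField Z)) :
    N.classRes (S.isOpen i) ((N.cusps (S.V i)).Dcusp c)
        (N.kummerAddHom (S.isOpen i) (S.isProper i) (Additive.ofMul g)) = 0 ↔
      u ∈ @unitsWithValueOne _ (N.NFFunctionField Z) _ _ (N.nfAlgebra Z)
        (N.nfPlace (T.hZb i) y hyNF hyr) := by
  letI := N.instGeomField Z
  letI := N.nfAlgebra Z
  set ĝ := Units.map (N.fieldRes (S.isOpen i)).symm.toRingHom.toMonoidHom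
    (g : (N.FunctionField (S.V i))ˣ) with hĝ
  have hrep' : N.toGeom (T.hZb i) (ĝ : N.FunctionField (S.Zb i)) = N.nfToGeom Z (u : N.NFFunctionField Z) := by
    rw [hĝ, Units.coe_map]; exact hrep
  have hordv := N.ord_nfPlace (T.hZb i) y hyNF hyr ĝ (u : N.NFFunctionField Z) hrep'
  have hdegK := N.hasCuspidalDegree_kummer (S.isProper i) P g c y hc
  constructor
  · intro h0
    -- degree `0` at `c`, hence `ord_y g = 0`
    have hI : N.classRes (S.isOpen i) ((N.cusps (S.V i)).Icusp c)
        (N.kummerAddHom (S.isOpen i) (S.isProper i) (Additive.ofMul g)) = 0 :=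
      N.classRes_eq_zero_of_le (S.isOpen i) ((N.cusps (S.V i)).Icusp_le_Dcusp c) _ h0
    have hdeg0 : CurveModel.HasCuspidalDegree P
        (N.kummerAddHom (S.isOpen i) (S.isProper i) (Additive.ofMul g)) c 0 :=
      (CurveModel.hasCuspidalDegree_zero_iff P _ c).2 hI
    have h00 := CurveModel.HasCuspidalDegree.unique' P hdeg0 hdegK
    have hord0 : Multiplicative.toAdd (N.ord y ĝ) = 0 := by
      rcases mul_eq_zero.mp h00.symm with h | h
      · exact absurd h (Units.ne_zero _)
      · exact h
    have hord : N.ord y ĝ = 1 := toAdd_eq_zero.mp hord0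
    exact (N.classRes_dcusp_kummer_eq_zero_iff_of_ord (S.isOpen i) (T.hZb i) (S.isProper i) c y hc hyNF
      hyr hkf g u hrep hord).1 h0
  · intro hu
    have hv0 : (N.nfPlace (T.hZb i) y hyNF hyr).ord (u : N.NFFunctionField Z) = 0 :=
      HasValue.ord_eq_zero ((mem_unitsWithValueOne_iff _ u).1 hu) one_ne_zero
    have hord : N.ord y ĝ = 1 := by
      apply toAdd_eq_zero.mp
      rw [← hordv]
      exact hv0
    exact (N.classRes_dcusp_kummer_eq_zero_iff_of_ord (S.isOpen i) (T.hZb i) (S.isProper i) c y hc hyNF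
      hyr hkf g u hrep hord).2 hu

/-! ### The value dictionary -/

section Values

variable [IsDirectedOrder ι]

/-- **If `u(v) = 1` at the place named by the index, then `HasValueOneAt (κ(g₀))` holds there**: at a
level where the index has become a cusp `c` filling `y` (naming `v`), the Kummer class of the restricted
representative vanishes on `D_c` (`classRes_dcusp_kummer_eq_zero_iff`).
[cite: MochizukiAbsTopIII2015, Thm 1.9 (e) p.38] -/
theorem hasValueOneAt_rep (h154 : Rmk_1_5_4_i.{u}) (h14i : N.Prop_1_4_i) (h14 : N.Prop_1_4_i')
    (h142 : N.Prop_1_4_ii) (hT14 : N.Prop_1_4_ii_transgression)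
    {j₀ : ι} (g₀ : N.regularUnits (S.V j₀)) (u : (N.NFFunctionField Z)ˣ)
    (hrep : letI := N.instGeomField Z;
      N.toGeom (T.hZb j₀) ((N.fieldRes (S.isOpen j₀)).symm ((g₀ : (N.FunctionField (S.V j₀))ˣ) : _)) =
        N.nfToGeom Z (u : N.NFFunctionField Z))
    (a : N.NFPointIndex S)
    (hu : u ∈ @unitsWithValueOne _ (N.NFFunctionField Z) _ _ (N.nfAlgebra Z)
      (N.nfPlace (T.hZb a.1) (N.ptRes (S.isOpen a.1) a.2.1)
        ((N.isNFPoint_ptRes (S.isOpen a.1) (S.isNFCurve a.1) a.2.1).2 a.2.2.1)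
        ((N.isRationalPt_ptRes (S.isOpen a.1) a.2.1).2 a.2.2.2))) :
    N.HasValueOneAt S (N.kummerToContainer S j₀ (Additive.ofMul g₀)) a := by
  letI := N.instGeomField Z
  obtain ⟨j, haj, hj₀j, c, y, hc, hy, hlies⟩ := N.exists_cusp_level S T a.2.1 a.2.2.1 j₀
  obtain ⟨P⟩ := N.nonempty_cuspSyncPresentation h14i h14 h142 hT14 (S.isOpen j) (S.isScheme j).1
    (S.isScheme j).2 (S.isProper j) (S.cuspsRational j)
  set gj : N.regularUnits (S.V j) :=
    Additive.toMul ((N.unitRes (T.hVW hj₀j)).comp (N.bcUnitRes (T.hWV hj₀j)) (Additive.ofMul g₀)) with hgj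
  refine ⟨j, haj, (N.cusps (S.V j)).Dcusp c, N.kummerAddHom (S.isOpen j) (S.isProper j) (Additive.ofMul gj),
    Or.inr ⟨c, rfl⟩, hlies, ?_, ?_⟩
  · rw [← N.kummerToContainer_res S T g₀ hj₀j]
    rfl
  · obtain ⟨hy1, hy2, hplace⟩ := N.nfPlace_eq_of_bcPt_eq S T haj a.2.1 a.2.2.1 a.2.2.2 y hy
    rw [hplace] at hu
    exact (N.classRes_dcusp_kummer_eq_zero_iff S T j P c y hc hy1 hy2 (h154 _ (S.isSubpadic j)) gj u
      (N.rep_res S T g₀ u hj₀j hrep)).2 hu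

/-- **Conversely, `HasValueOneAt (κ(g₀))` at an index forces `u(v) = 1`**: a representing class `η′`
vanishing on a decomposition group `D` of level `j′` over the index agrees with a level Kummer class
`κ_k` of `u` after transition; by the restriction calculus (`CyclotomeH1Restriction.lean`: conjugation,
pull-back, change of coefficients) `κ_k` vanishes on every subgroup of level `k` mapping into a conjugate
of `D` — a point or cusp decomposition group over the index (fibre law, cusp lifting) — and the point /
cusp readings give `u(v) = 1`. [cite: MochizukiAbsTopIII2015, Thm 1.9 (e) p.38] -/
theorem mem_of_hasValueOneAt_rep (h154 : Rmk_1_5_4_i.{u}) (h14i : N.Prop_1_4_i) (h14 : N.Prop_1_4_i')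
    (h142 : N.Prop_1_4_ii) (hT14 : N.Prop_1_4_ii_transgression) (hZ : N.IsThm19dInput Z)
    {j₀ : ι} (g₀ : N.regularUnits (S.V j₀)) (u : (N.NFFunctionField Z)ˣ)
    (hrep : letI := N.instGeomField Z;
      N.toGeom (T.hZb j₀) ((N.fieldRes (S.isOpen j₀)).symm ((g₀ : (N.FunctionField (S.V j₀))ˣ) : _)) =
        N.nfToGeom Z (u : N.NFFunctionField Z))
    (a : N.NFPointIndex S)
    (hval : N.HasValueOneAt S (N.kummerToContainer S j₀ (Additive.ofMul g₀)) a) :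
    u ∈ @unitsWithValueOne _ (N.NFFunctionField Z) _ _ (N.nfAlgebra Z)
      (N.nfPlace (T.hZb a.1) (N.ptRes (S.isOpen a.1) a.2.1)
        ((N.isNFPoint_ptRes (S.isOpen a.1) (S.isNFCurve a.1) a.2.1).2 a.2.2.1)
        ((N.isRationalPt_ptRes (S.isOpen a.1) a.2.1).2 a.2.2.2)) := by
  letI := N.instGeomField Z
  obtain ⟨j', haj', D, η', hD, hlies, hcont, hres0⟩ := hval
  -- a common level where `η'` and the Kummer class of `u` agree
  obtain ⟨k, hj'k, hj₀k, hk⟩ := (S.toContainer_eq_toContainer_iff _ _).1 hcont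
  set gk : N.regularUnits (S.V k) :=
    Additive.toMul ((N.unitRes (T.hVW hj₀k)).comp (N.bcUnitRes (T.hWV hj₀k)) (Additive.ofMul g₀)) with hgk
  have hk' : S.transition j' k hj'k (N.pushToZ S j' η') =
      N.pushToZ S k (N.kummerAddHom (S.isOpen k) (S.isProper k) (Additive.ofMul gk)) := by
    rw [hk]
    exact N.transition_kummerLevel S T g₀ hj₀k
  have hpush := N.push_eq_pull_of_transition_eq S T hj'k η' _ hk'
  have hrepk := N.rep_res S T g₀ u hj₀k hrep
  have hkfk : IsKummerFaithful (N.base (S.V k)) := h154 _ (S.isSubpadic k)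
  -- `κ_k` vanishes on every subgroup of level `k` mapping into a conjugate of `D`
  have hzero : ∀ (Dk : Subgroup (N.ext (S.V k)).arith) (g : (N.ext (S.V j')).arith),
      Dk.map (S.trans hj'k).arith.toMonoidHom ≤ MulAut.conj g • D →
        N.classRes (S.isOpen k) Dk (N.kummerAddHom (S.isOpen k) (S.isProper k) (Additive.ofMul gk)) = 0 := by
    intro Dk g hle
    have h1 : (cyclotomeModH1Res (N.res (S.isOpen j')) ZHatCoeff.{u}
        (Dk.map (N.res (T.hVW hj'k) ≫ N.bc (T.hWV hj'k)).arith.toMonoidHom)).hom η' = 0 := by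
      rw [← T.trans_eq hj'k]
      have h2 : (cyclotomeModH1Res (N.res (S.isOpen j')) ZHatCoeff.{u} (MulAut.conj g • D)).hom η' = 0 :=
        (res_conj_eq_zero_iff ZHatCoeff.{u} (N.res (S.isOpen j')) D g η').2 hres0
      exact cyclotomeModH1Res_eq_zero_of_le (N.res (S.isOpen j')) ZHatCoeff.{u} hle η' h2
    have h3 := (res_pull_eq_zero_iff ZHatCoeff.{u} (N.res (S.isOpen j')) (N.res (T.hVW hj'k) ≫ N.bc (T.hWV hj'k))
      (N.res (S.isOpen k) ≫ N.bc (T.hZZ hj'k)) (N.trans_sq S T hj'k) Dk η').2 h1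
    rw [← hpush] at h3
    exact (res_push_eq_zero_iff ZHatCoeff.{u} (N.res (S.isOpen k)) (N.bc (T.hZZ hj'k))
      (N.isBaseChange_bc (T.hZZ hj'k)) Dk _).1 h3
  obtain ⟨Pk⟩ := N.nonempty_cuspSyncPresentation h14i h14 h142 hT14 (S.isOpen k) (S.isScheme k).1
    (S.isScheme k).2 (S.isProper k) (S.cuspsRational k)
  -- the readings at level `k`
  have cuspCase : ∀ (ck : (N.cusps (S.V k)).Cusp) (g : (N.ext (S.V j')).arith),
      ((N.cusps (S.V k)).Dcusp ck).map (S.trans hj'k).arith.toMonoidHom ≤ MulAut.conj g • D →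
      N.LiesOver S (haj'.trans hj'k) ((N.cusps (S.V k)).Dcusp ck) a.2.1 →
        u ∈ @unitsWithValueOne _ (N.NFFunctionField Z) _ _ (N.nfAlgebra Z)
          (N.nfPlace (T.hZb a.1) (N.ptRes (S.isOpen a.1) a.2.1)
            ((N.isNFPoint_ptRes (S.isOpen a.1) (S.isNFCurve a.1) a.2.1).2 a.2.2.1)
            ((N.isRationalPt_ptRes (S.isOpen a.1) a.2.1).2 a.2.2.2)) := by
    intro ck g hle hliesk
    obtain ⟨yk, hyk⟩ := Option.isSome_iff_exists.mp (N.cuspPt_isSome (S.isOpen k) (S.isProper k) ck)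
    have hyk' := N.bcPt_eq_of_dcusp_liesOver S T h154 h14i hZ (haj'.trans hj'k) ck a.2.1 hliesk yk hyk
    obtain ⟨hy1, hy2, hplace⟩ := N.nfPlace_eq_of_bcPt_eq S T (haj'.trans hj'k) a.2.1 a.2.2.1 a.2.2.2 yk hyk'
    rw [hplace]
    exact (N.classRes_dcusp_kummer_eq_zero_iff S T k Pk ck yk hyk hy1 hy2 hkfk gk u hrepk).1
      (hzero _ g hle)
  rcases hD with ⟨w', hw'NF, rfl⟩ | ⟨c', rfl⟩
  · -- `D = D_{w'}`: the structure of level `k` over `w'`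
    obtain ⟨p, hp⟩ := N.bcPt_surjective (T.hZZ hj'k) (N.ptRes (S.isOpen j') w')
    obtain ⟨w₀, hw₀, hw₀x⟩ :=
      N.exists_pt_bc_open (T.hWV hj'k) (T.hZZ hj'k) (S.isOpen j') (T.hWZ hj'k) w' p hp
    have hpa : N.bcPt (T.hZZ (haj'.trans hj'k)) p = N.ptRes (S.isOpen a.1) a.2.1 := by
      rw [← N.bcPt_comp (T.hZZ hj'k) (T.hZZ haj') (T.hZZ (haj'.trans hj'k)), hp]
      exact N.bcPt_ptRes_eq_of_liesOver S T h154 hZ haj' w' a.2.1 hlies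
    rcases N.exists_ptRes_or_cuspPt (T.hVW hj'k) w₀ with ⟨wk, hwk⟩ | ⟨ck, hck⟩
    · -- a point `wk` of `V_k` over `w'`
      have himg : N.bcPt (T.hWV hj'k) (N.ptRes (T.hVW hj'k) wk) = w' := by rw [hwk, hw₀x]
      obtain ⟨g, hg⟩ := N.liesOver_decomp_imgPt S T hj'k wk
      rw [himg] at hg
      have h0 := hzero (N.decomp (S.V k) wk) g hg
      have hpk : N.ptRes (S.isOpen k) wk = p := by
        rw [N.ptRes_comp (T.hVW hj'k) (T.hWZ hj'k) (S.isOpen k), hwk, hw₀]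
      have hwkr : N.IsRationalPt (S.V k) wk := by
        rw [← N.isRationalPt_ptRes (S.isOpen k) wk, hpk]
        refine N.isRationalPt_of_bcPt (T.hZZ (haj'.trans hj'k)) p ?_
        rw [hpa]
        exact (N.isRationalPt_ptRes (S.isOpen a.1) a.2.1).2 a.2.2.2
      obtain ⟨hy1, hy2, hplace⟩ := N.nfPlace_eq_of_bcPt_eq S T (haj'.trans hj'k) a.2.1 a.2.2.1 a.2.2.2
        (N.ptRes (S.isOpen k) wk) (by rw [hpk, hpa])
      rw [hplace]
      exact (N.classRes_decomp_kummer_eq_zero_iff (S.isOpen k) (T.hZb k) (S.isProper k) wk hy1 hwkr hkfk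
        gk u hrepk).1 h0
    · -- a cusp `ck` of `V_k` filling `w₀`
      obtain ⟨g, hg⟩ := N.liesOver_dcusp_of_cuspPt S T hj'k ck w₀ hck
      rw [hw₀x] at hg
      refine cuspCase ck g hg ?_
      refine N.liesOver_of_map_le S haj' hj'k _ _ a.2.1 g hg hlies
  · -- `D = D_{c'}`: lift the cusp
    obtain ⟨ck, -, g, hck⟩ := N.exists_cusp_above S T hj'k c'
    rw [← T.trans_eq hj'k] at hck
    exact cuspCase ck g hck (N.liesOver_of_map_le S haj' hj'k _ _ a.2.1 g hck hlies)

/-- **The value dictionary (e3) for a represented element**: `HasValueOneAt (κ(g₀)) a ↔ u ∈ U_{π(a)}`.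
[cite: MochizukiAbsTopIII2015, Thm 1.9 (e) p.38] -/
theorem hasValueOneAt_rep_iff (h154 : Rmk_1_5_4_i.{u}) (h14i : N.Prop_1_4_i) (h14 : N.Prop_1_4_i')
    (h142 : N.Prop_1_4_ii) (hT14 : N.Prop_1_4_ii_transgression) (hZ : N.IsThm19dInput Z)
    {j₀ : ι} (g₀ : N.regularUnits (S.V j₀)) (u : (N.NFFunctionField Z)ˣ)
    (hrep : letI := N.instGeomField Z;
      N.toGeom (T.hZb j₀) ((N.fieldRes (S.isOpen j₀)).symm ((g₀ : (N.FunctionField (S.V j₀))ˣ) : _)) =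
        N.nfToGeom Z (u : N.NFFunctionField Z))
    (a : N.NFPointIndex S) :
    N.HasValueOneAt S (N.kummerToContainer S j₀ (Additive.ofMul g₀)) a ↔
      u ∈ @unitsWithValueOne _ (N.NFFunctionField Z) _ _ (N.nfAlgebra Z)
        (N.nfPlace (T.hZb a.1) (N.ptRes (S.isOpen a.1) a.2.1)
          ((N.isNFPoint_ptRes (S.isOpen a.1) (S.isNFCurve a.1) a.2.1).2 a.2.2.1)
          ((N.isRationalPt_ptRes (S.isOpen a.1) a.2.1).2 a.2.2.2)) :=
  ⟨N.mem_of_hasValueOneAt_rep S T h154 h14i h14 h142 hT14 hZ g₀ u hrep a,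
    N.hasValueOneAt_rep S T h154 h14i h14 h142 hT14 g₀ u hrep a⟩

end Values

end PlacedKummerModelV2

end Literature.AnabelianGeometry.AbsoluteAnabelian.AbsTopIII
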